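import Summits.ABC.ABC.Theorems.IUTThetaPilotThetaPartIIStubHullVolumePerImage
import Summits.ABC.IUTFork.LDHSlotResidueMixedShare
import Literature.IUT.LogVolume.GenuineLogThetaUnionPerImageResidue
import Literature.IUT.LogVolume.GenuineSupportPrimesBoundPinned
import HarnessLib

/-!
# The fork at [IUTchIII] Corollary 3.12, L-DH level: AT THE `λ`-LINE the open union binder (ii′-U) IS the closed
# per-image line (ii′-P) with the constant lowered by the (Ind1) slot residue of the datum — up to the Step (iii) sum
# `Σ_{p∈T(I)} log p ≤ 2·d_mod·(log-diff + log-cond) + log(30·l)` (abc-iut cell; crux ThetaPartII = stmt-ABC-19678; CONE binder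
# `hvol` of `abc_of_S_v3` / `hreg` of `abc_of_S_v4`)

Record-only PROOF file (D-0012) of the abc-iut cell (R2 S-chain seat abc-iut-s2-p2; sequel to this seat's Literature files
`TensorPacketSlotContent` / `GenuineLogThetaPerImageExactVolume` / `GenuineLogThetaUnionPerImageResidue` («reading (U) −
reading (P) = slot residue ± Σ log p») and `LDHSlotResidueMixedShare` (residue = mixed `log(q)`-share)). TAKES NO SIDE on
[IUTchIII] Cor. 3.12 or on which reading print's `−|log(Θ)|` is. S. Mochizuki, *IUT III* [Mochizuki2012] Cor. 3.12 p. 174 /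
proof Step (x) p. 181; *IUT IV* Thm. 1.10 proof Steps (ii)–(viii) pp. 24–31 (Step (iii) p. 26: `log(𝔰)`; Step (v) p. 27–28);
Cor. 2.2 (ii) proof p. 46; Dupuy–Hilado [DupuyHilado2025] §4.7, §4.9–4.12.

THE POINT. The cell's per-image line is CLOSED: abc-iut-c312-d1/S3/S7 `ThetaPartII.hullVolumePerImageAtDatum_BIII` (p425589):
`Cor22.HullVolumePerImageAtDatum P l (B_III P l)` at every admissible `(P, l)`, EVERY datum, no slot-constancy. The union
line's binder `Cor22.HullVolumeAtDatum P l (B_III P l)` is OPEN at `d_mod ≥ 2` (VERDICT RISK ¶7). By this seat's input-level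
identity the two DEFINED numbers differ by exactly the slot residue up to `Σ_{p∈T(I)} log p`, and abc-iut-S3's Step (iii) bound
`Cor22.ThetaVolumeDatumAt.sum_log_supportPrimes_le_pinned` makes that sum a function of the POINT. Hence, at the `λ`-line:

* `PointDict.hullEstimatePerImageOf_of_hullEstimateOf_residue` / `hullEstimateOf_of_hullEstimatePerImageOf_residue` — per datum:
  `T.HullEstimateOf δ → T.HullEstimatePerImageOf (δ − slotResidue(T) + Σ_{T(I)} log p)` and
  `T.HullEstimatePerImageOf δ → T.HullEstimateOf (δ + slotResidue(T) + Σ_{T(I)} log p)`;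
* **`PointDict.hullEstimatePerImageOf_sub_slotResidue_of_hullVolumeAtDatum`** — NECESSITY, sharp form: `Cor22.HullVolumeAtDatum P l δ`
  (`λ ∈ U_P` minimal) forces, at EVERY datum `T`, the PER-IMAGE estimate with the constant
  `δ − slotResidue(T) + 2·d_mod·(log-diff + log-cond) + log(30·l)` — abc-iut-S8's `slotResidue ≤ δ` is the special case
  «per-image discrepancy ≥ 0»; here the whole per-image discrepancy is retained;
* **`PointDict.hullEstimateOf_BIII_add_slotResidue`** / **`hullVolumeAtDatum_BIII_add_of_slotResidue_le`** — SUFFICIENCY from the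
  CLOSED line: at admissible `(P, l)` ((P6) gives `7 ≤ l`), EVERY datum satisfies the union estimate with constant
  `B_III(P,l) + slotResidue(T) + 2·d_mod·(log-diff + log-cond) + log(30·l)`; so `Cor22.HullVolumeAtDatum P l (B_III + ρ + 2·d_mod·(…) + log(30·l))`
  whenever every datum's residue is `≤ ρ` — in particular (F1/F2 `slotResidue_le_mixedShare`) whenever the mixed `log(q)`-share of
  `λ` is `≤ (24/(l(l+1)))·…·ρ`;
* `PointDict.hullVolumeAtDatum_iff_perImage_lowered` — the two directions side by side: the OPEN binder at `(P,l)` sits between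
  «(ii′-P) at every `T` with constant `B − slotResidue(T) − E(P,l)`» (sufficient) and «… with constant `B − slotResidue(T) + E(P,l)`»
  (necessary), `E(P,l) = 2·d_mod·(log-diff + log-cond) + log(30·l)`.
READING (for the planners; nothing asserted about print): closing `hvol`/`hreg` at `d_mod ≥ 2` = improving the CLOSED per-image
constant `B_III` at each datum by that datum's slot residue (≈ the `((l+1)/24)·log(q)`-share of the bad/good-mixed primes of
`F_mod`, `LDHSlotResidueMixedShare`), give or take `E(P,l)`; the per-image discrepancy itself is pilot-dependent only through
finitely many lattice contents (`GenuineLogThetaPerImageExactVolume`). A Szpiro/abc-type condition on the point in either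
direction; no datum constructed; no side taken; typed ≠ proved. PROOF-ONLY file: 0 definitions, no `Prop` facts.
[cite: Mochizuki2012, IUTchIII Cor. 3.12 p. 174; proof Step (x) p. 181] [cite: Mochizuki2012, IUTchIV Thm. 1.10 proof Steps (ii)–(viii) p. 24–31]
[cite: DupuyHilado2025, §4.7, §4.9, §4.11, §4.12] [claim: Mochizuki2012, status: disputed] for every IUT quotation.
-/

noncomputable section

namespace Summit.ABC.IUTFork

namespace PointDict

open Literature.IUT.LogVolume Literature.IUT.HodgeTheaters Literature.NumberTheory.DiophantineGeometry.GenEll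
open NumberField IsDedekindDomain

variable {P : NFPoint} {l : ℕ}

/-- **Per datum, (U) ⇒ (P) with the constant lowered by the residue**: `T.HullEstimateOf δ →
T.HullEstimatePerImageOf (δ − slotResidue(T) + Σ_{p∈T(I)} log p)`. [cite: Mochizuki2012, IUTchIV Thm. 1.10 Steps (v)–(viii) p. 27–31] -/
theorem hullEstimatePerImageOf_of_hullEstimateOf_residue (T : Cor22.ThetaVolumeDatumAt P l) {δ : ℝ}
    (h : T.HullEstimateOf δ) :
    T.HullEstimatePerImageOf (δ -
      (letI := T.instFieldF; letI := T.instNumberFieldF; letI := T.instFieldK; letI := T.instNumberFieldK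
       letI := T.instAlgebraK
       T.I.X.slotResidue T.I.supportPrimes - ∑ p ∈ T.I.supportPrimes, Real.log (p : ℝ))) := by
  letI := T.instFieldF; letI := T.instNumberFieldF; letI := T.instFieldK; letI := T.instNumberFieldK
  letI := T.instAlgebraK
  have h1 := T.I.hullEstimatePerImageOf_of_hullEstimateOf_residue h
  have heq : δ - (T.I.X.slotResidue T.I.supportPrimes - ∑ p ∈ T.I.supportPrimes, Real.log (p : ℝ)) =
      δ - T.I.X.slotResidue T.I.supportPrimes + ∑ p ∈ T.I.supportPrimes, Real.log (p : ℝ) := by ring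
  show T.I.HullEstimatePerImageOf _
  rw [heq]
  exact h1

/-- **Per datum, (P) ⇒ (U) plus the residue**: `T.HullEstimatePerImageOf δ → T.HullEstimateOf (δ + slotResidue(T) + Σ_{p∈T(I)} log p)`.
[cite: Mochizuki2012, IUTchIV Thm. 1.10 Steps (v)–(viii) p. 27–31] -/
theorem hullEstimateOf_of_hullEstimatePerImageOf_residue (T : Cor22.ThetaVolumeDatumAt P l) {δ : ℝ}
    (h : T.HullEstimatePerImageOf δ) :
    T.HullEstimateOf (δ +
      (letI := T.instFieldF; letI := T.instNumberFieldF; letI := T.instFieldK; letI := T.instNumberFieldK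
       letI := T.instAlgebraK
       T.I.X.slotResidue T.I.supportPrimes + ∑ p ∈ T.I.supportPrimes, Real.log (p : ℝ))) := by
  letI := T.instFieldF; letI := T.instNumberFieldF; letI := T.instFieldK; letI := T.instNumberFieldK
  letI := T.instAlgebraK
  have h1 := T.I.hullEstimateOf_of_hullEstimatePerImageOf_residue h
  have heq : δ + (T.I.X.slotResidue T.I.supportPrimes + ∑ p ∈ T.I.supportPrimes, Real.log (p : ℝ)) =
      δ + T.I.X.slotResidue T.I.supportPrimes + ∑ p ∈ T.I.supportPrimes, Real.log (p : ℝ) := by ring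
  show T.I.HullEstimateOf _
  rw [heq]
  exact h1

/-- **NECESSITY, sharp form at the `λ`-line**: `Cor22.HullVolumeAtDatum P l δ` (`λ ∈ U_P` minimal) forces, at every datum `T`,
the PER-IMAGE estimate `T.HullEstimatePerImageOf (δ − slotResidue(T) + 2·d_mod·(log-diff + log-cond) + log(2·3·5·l))` (abc-iut-S3's
Step (iii) bound for `Σ_{p∈T(I)} log p`). [cite: Mochizuki2012, IUTchIV Thm. 1.10 proof Step (iii) p. 26, Step (v) p. 27–28]
[claim: Mochizuki2012, status: disputed] -/
theorem hullEstimatePerImageOf_sub_slotResidue_of_hullVolumeAtDatum (hP : P ∈ UP) {δ : ℝ}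
    (h : Cor22.HullVolumeAtDatum P l δ) (T : Cor22.ThetaVolumeDatumAt P l) :
    T.HullEstimatePerImageOf (δ -
      (letI := T.instFieldF; letI := T.instNumberFieldF; letI := T.instFieldK; letI := T.instNumberFieldK
       letI := T.instAlgebraK
       T.I.X.slotResidue T.I.supportPrimes) +
      (2 * (Cor22.dmod P : ℝ) * (P.logDiff + Cor22.logCondAvoid P {2, l}) + Real.log (2 * 3 * 5 * (l : ℝ)))) := by
  letI := T.instFieldF; letI := T.instNumberFieldF; letI := T.instFieldK; letI := T.instNumberFieldK
  letI := T.instAlgebraK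
  have h1 : T.I.HullEstimatePerImageOf
      (δ - T.I.X.slotResidue T.I.supportPrimes + ∑ p ∈ T.I.supportPrimes, Real.log (p : ℝ)) :=
    T.I.hullEstimatePerImageOf_of_hullEstimateOf_residue (h T)
  have h2 : ∑ q ∈ T.I.supportPrimes, Real.log (q : ℝ) ≤
      2 * (Cor22.dmod P : ℝ) * (P.logDiff + Cor22.logCondAvoid P {2, l}) + Real.log (2 * 3 * 5 * (l : ℝ)) :=
    T.sum_log_supportPrimes_le_pinned hP
  show T.I.HullEstimatePerImageOf _
  exact T.I.hullEstimatePerImageOf_mono h1 (by linarith)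

/-- **SUFFICIENCY from the CLOSED per-image line**: at admissible `(P, l)` (`λ ∈ U_P` minimal, `l` prime `≥ 5`, (P6)) EVERY datum
`T` satisfies the UNION estimate with constant `B_III(P,l) + slotResidue(T) + 2·d_mod·(log-diff + log-cond) + log(2·3·5·l)`
(abc-iut-c312-d1/S3 `ThetaPartII.hullVolumePerImageAtDatum_BIII`, p425589, plus the residue).
[cite: Mochizuki2012, IUTchIV Thm. 1.10 proof Steps (ii)–(viii) p. 24–31] [claim: Mochizuki2012, status: disputed] -/
theorem hullEstimateOf_BIII_add_slotResidue (hP : P ∈ UP) (hl : l.Prime) (h5 : 5 ≤ l) (h6 : Cor22.CondP6 P l)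
    (T : Cor22.ThetaVolumeDatumAt P l) :
    T.HullEstimateOf
      (((l : ℝ) + 1) / 4 * ((1 + 12 * (Cor22.dmod P : ℝ) / l) * (P.logDiff + Cor22.logCondAvoid P {2, l})
          + 2 * Real.log l + 52
          + 20 / 3 * Real.log (((2 ^ 12 * 3 ^ 3 * 5 * Cor22.dmod P : ℕ) : ℝ) * (l : ℝ))
            * (Nat.primeCounting (2 ^ 12 * 3 ^ 3 * 5 * Cor22.dmod P * l) : ℝ)) +
        (letI := T.instFieldF; letI := T.instNumberFieldF; letI := T.instFieldK; letI := T.instNumberFieldK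
         letI := T.instAlgebraK
         T.I.X.slotResidue T.I.supportPrimes) +
        (2 * (Cor22.dmod P : ℝ) * (P.logDiff + Cor22.logCondAvoid P {2, l}) + Real.log (2 * 3 * 5 * (l : ℝ)))) := by
  letI := T.instFieldF; letI := T.instNumberFieldF; letI := T.instFieldK; letI := T.instNumberFieldK
  letI := T.instAlgebraK
  have hP' := Summit.ABC.ABC.Theorems.ThetaPartII.hullVolumePerImageAtDatum_BIII hP hl h5 h6 T
  have h1 : T.HullEstimateOf
      (((l : ℝ) + 1) / 4 * ((1 + 12 * (Cor22.dmod P : ℝ) / l) * (P.logDiff + Cor22.logCondAvoid P {2, l})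
          + 2 * Real.log l + 52
          + 20 / 3 * Real.log (((2 ^ 12 * 3 ^ 3 * 5 * Cor22.dmod P : ℕ) : ℝ) * (l : ℝ))
            * (Nat.primeCounting (2 ^ 12 * 3 ^ 3 * 5 * Cor22.dmod P * l) : ℝ)) +
        T.I.X.slotResidue T.I.supportPrimes + ∑ p ∈ T.I.supportPrimes, Real.log (p : ℝ)) :=
    T.I.hullEstimateOf_of_hullEstimatePerImageOf_residue hP'
  have h2 : ∑ q ∈ T.I.supportPrimes, Real.log (q : ℝ) ≤
      2 * (Cor22.dmod P : ℝ) * (P.logDiff + Cor22.logCondAvoid P {2, l}) + Real.log (2 * 3 * 5 * (l : ℝ)) :=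
    T.sum_log_supportPrimes_le_pinned hP
  exact T.hullEstimateOf_mono h1 ((add_le_add_iff_left _).mpr h2)

/-- **The union binder with the residue ADDED is a THEOREM**: at admissible `(P, l)`, if every datum's slot residue is `≤ ρ`,
then `Cor22.HullVolumeAtDatum P l (B_III(P,l) + ρ + 2·d_mod·(log-diff + log-cond) + log(2·3·5·l))` — the exact price of the union
reading over the per-image reading is the residue (plus the Step (iii) rounding). [cite: Mochizuki2012, IUTchIV Thm. 1.10 proof Steps (ii)–(viii) p. 24–31]
[claim: Mochizuki2012, status: disputed] -/
theorem hullVolumeAtDatum_BIII_add_of_slotResidue_le (hP : P ∈ UP) (hl : l.Prime) (h5 : 5 ≤ l) (h6 : Cor22.CondP6 P l)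
    {ρ : ℝ}
    (hρ : ∀ T : Cor22.ThetaVolumeDatumAt P l,
      (letI := T.instFieldF; letI := T.instNumberFieldF; letI := T.instFieldK; letI := T.instNumberFieldK
       letI := T.instAlgebraK
       T.I.X.slotResidue T.I.supportPrimes) ≤ ρ) :
    Cor22.HullVolumeAtDatum P l
      (((l : ℝ) + 1) / 4 * ((1 + 12 * (Cor22.dmod P : ℝ) / l) * (P.logDiff + Cor22.logCondAvoid P {2, l})
          + 2 * Real.log l + 52
          + 20 / 3 * Real.log (((2 ^ 12 * 3 ^ 3 * 5 * Cor22.dmod P : ℕ) : ℝ) * (l : ℝ))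
            * (Nat.primeCounting (2 ^ 12 * 3 ^ 3 * 5 * Cor22.dmod P * l) : ℝ)) + ρ +
        (2 * (Cor22.dmod P : ℝ) * (P.logDiff + Cor22.logCondAvoid P {2, l}) + Real.log (2 * 3 * 5 * (l : ℝ)))) := by
  intro T
  letI := T.instFieldF; letI := T.instNumberFieldF; letI := T.instFieldK; letI := T.instNumberFieldK
  letI := T.instAlgebraK
  have h1 := hullEstimateOf_BIII_add_slotResidue hP hl h5 h6 T
  have h2 : T.I.X.slotResidue T.I.supportPrimes ≤ ρ := hρ T
  exact T.hullEstimateOf_mono h1 (by linarith)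

/-- **The open binder, sandwiched by the closed line.** At `(P, l)` with `λ ∈ U_P` minimal, writing `E(P,l) = 2·d_mod·(log-diff +
log-cond) + log(2·3·5·l)`: (i) if every datum satisfies the per-image estimate with constant `δ − slotResidue(T) − E(P,l)` then
`Cor22.HullVolumeAtDatum P l δ`; (ii) if `Cor22.HullVolumeAtDatum P l δ` then every datum satisfies the per-image estimate with
constant `δ − slotResidue(T) + E(P,l)`. [cite: Mochizuki2012, IUTchIV Thm. 1.10 proof Steps (iii), (v) p. 26–28]
[claim: Mochizuki2012, status: disputed] -/
theorem hullVolumeAtDatum_iff_perImage_lowered (hP : P ∈ UP) {δ : ℝ} :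
    ((∀ T : Cor22.ThetaVolumeDatumAt P l, T.HullEstimatePerImageOf (δ -
        (letI := T.instFieldF; letI := T.instNumberFieldF; letI := T.instFieldK; letI := T.instNumberFieldK
         letI := T.instAlgebraK
         T.I.X.slotResidue T.I.supportPrimes) -
        (2 * (Cor22.dmod P : ℝ) * (P.logDiff + Cor22.logCondAvoid P {2, l}) + Real.log (2 * 3 * 5 * (l : ℝ))))) →
      Cor22.HullVolumeAtDatum P l δ) ∧
    (Cor22.HullVolumeAtDatum P l δ → ∀ T : Cor22.ThetaVolumeDatumAt P l, T.HullEstimatePerImageOf (δ -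
        (letI := T.instFieldF; letI := T.instNumberFieldF; letI := T.instFieldK; letI := T.instNumberFieldK
         letI := T.instAlgebraK
         T.I.X.slotResidue T.I.supportPrimes) +
        (2 * (Cor22.dmod P : ℝ) * (P.logDiff + Cor22.logCondAvoid P {2, l}) + Real.log (2 * 3 * 5 * (l : ℝ))))) := by
  refine ⟨fun h T => ?_, fun h T => hullEstimatePerImageOf_sub_slotResidue_of_hullVolumeAtDatum hP h T⟩
  letI := T.instFieldF; letI := T.instNumberFieldF; letI := T.instFieldK; letI := T.instNumberFieldK
  letI := T.instAlgebraK
  have h1 : T.HullEstimateOf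
      (δ - T.I.X.slotResidue T.I.supportPrimes -
          (2 * (Cor22.dmod P : ℝ) * (P.logDiff + Cor22.logCondAvoid P {2, l}) + Real.log (2 * 3 * 5 * (l : ℝ))) +
        T.I.X.slotResidue T.I.supportPrimes + ∑ p ∈ T.I.supportPrimes, Real.log (p : ℝ)) :=
    T.I.hullEstimateOf_of_hullEstimatePerImageOf_residue (h T)
  have h2 : ∑ q ∈ T.I.supportPrimes, Real.log (q : ℝ) ≤
      2 * (Cor22.dmod P : ℝ) * (P.logDiff + Cor22.logCondAvoid P {2, l}) + Real.log (2 * 3 * 5 * (l : ℝ)) :=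
    T.sum_log_supportPrimes_le_pinned hP
  exact T.hullEstimateOf_mono h1 (by linarith)

/-- **At slot-constant data the two readings have the SAME number** (`negLogTheta`, nonarchimedean parts): e.g. every datum over
`F_mod = ℚ`. [cite: Mochizuki2012, IUTchIV Thm. 1.10 Step (v) p. 28] -/
theorem negLogThetaNonarch_eq_perImage_of_slotValue_const (T : Cor22.ThetaVolumeDatumAt P l)
    (hconst : letI := T.instFieldF; letI := T.instNumberFieldF; letI := T.instAlgebraF; letI := T.instFieldK
      letI := T.instNumberFieldK; letI := T.instAlgebraK; letI := T.instFieldFbar; letI := T.instAlgebraFbar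
      letI := T.instAlgebraKFbar; letI := T.instIsElliptic
      ∀ p ∈ T.I.supportPrimes, ∀ (i : Fin T.I.X.lstar) (v w : placesOver (fieldOfModuli T.E) p),
        T.I.X.slotValue i v.1 = T.I.X.slotValue i w.1) :
    (letI := T.instFieldF; letI := T.instNumberFieldF; letI := T.instFieldK; letI := T.instNumberFieldK
     letI := T.instAlgebraK
     T.I.negLogThetaNonarch = T.I.negLogThetaPerImageNonarch) := by
  letI := T.instFieldF; letI := T.instNumberFieldF; letI := T.instAlgebraF; letI := T.instFieldK
  letI := T.instNumberFieldK; letI := T.instAlgebraK; letI := T.instFieldFbar; letI := T.instAlgebraFbar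
  letI := T.instAlgebraKFbar; letI := T.instIsElliptic
  exact T.I.negLogThetaNonarch_eq_perImage_of_slotConstant hconst

end PointDict

end Summit.ABC.IUTFork

end
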